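import Summits.BirchSwinnertonDyer.Rank1Residual.ManinAdditive.TwistOrbitManinTransportAtTwoExact
import HarnessLib

/-!
# COMMUTING twist orbits at `2`, EXACT — FILE 3/4 of T-an-7 (`TwistOrbitAtTwoExactDegree`): E-an-22
# `ExactEvenCommutingOrbitManinChain` (`c′ ∣ c ∣ d·c′`), E-an-23 `NegOneCommutingOrbitManinDegEq` (`χ₋₄`:
# `c′ = ±c ∧ deg′ = deg`, PROVED for `16 ∣ M`), E-an-24 `TwoCommutingOrbitManinDegDichotomy` (`χ±8`:
# `(c′ = ±c ∧ deg′ = 2deg) ∨ (c = ±2c′ ∧ deg = 2deg′)`, PROVED for `64 ∣ M`) (§19)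

PROVENANCE. Cell `bsd-f2-manin`, planner `bsd-f2-manin-an` g4: §19 of the kernel-checked HOME/an/Sketch-an5v3.lean
7cd536ef1a662bfb, landed VERBATIM by the cell's typer (T-an-7, file 3/4; file 1/4 = `HalfTranslateTwistStep`, whose
module docstring has the full provenance).  The three `def … : Prop` below are parameterised statement SCHEMAS (like
those of `TwistOrbitManinStatements.lean`), each closed at the admissible parameters by a PROVED theorem in this file
(`exactEvenCommutingOrbitManinChain_negOne/_two/_negTwo`, `negOneCommutingOrbitManinDegEq_holds (16 ∣ M)`,
`twoCommutingOrbitManinDegDichotomy_two/_negTwo (64 ∣ M)`); no `sorry`, no conjecture tags.  They supersede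
mathematically the factor-2 statements of the T-an-6b add-on (E-an-18r `EvenCommutingOrbitManinChain`, E-an-20
`TwoCommutingOrbitDegreeTetrachotomy` in `TwistOrbitAtTwoA3EvenDegree` / `…A4ExactAtTwo`), which stay as history.

CONTENT (§19).  `exactEvenCommutingOrbitManinChain_of_char` (generic: clause 1 = clause 1 of §18 with `C = W′`;
clause 2 = the engine run BACKWARDS with `r = d`, needing HALF-TRANSLATE for `f_{W′}`); the PROVED edge E-an-22 ⇒ the
landed E-an-12c `CommutingOrbitManinChain d 2 M` (`d ∣ 2`); `orbitDegreeIdentity_two_of_char` (S-an-14 at `2`,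
hypothesis-free: `deg′·c² = |d|·deg·c′²`); the ℤ-lemma `degDichotomy_of_chain`; E-an-23 / E-an-24 and their closers.
BC5 (Cremona `N < 5·10⁵`, `2⁵ ∣ N`): equal degrees and `#1 ↦ #1` on 148 277 / 148 277 χ₋₄ same-level orbits
(modular-symbol slice `N < 14 000`: 2 877 / 2 877); χ±8 commuting orbits 28 112, degree ratio 2 on all (E-an-24 first
branch); falsifiers 0 (HOME/MEMO-an.md §40).  Beyond print: yes (small, unconditional).
References: [cite: Stevens1989, Lemma (5.4) p. 97] [cite: Pal2012, Lemma 3.1] [cite: Watkins2002, §2.1].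
-/

noncomputable section

open scoped MatrixGroups ModularForm

open CongruenceSubgroup WeierstrassCurve
  Literature.NumberTheory.DiophantineGeometry
  Literature.NumberTheory.EllipticCurves
  Literature.NumberTheory.EllipticCurves.ModularForms

namespace Summit.BirchSwinnertonDyer.Rank1Residual.ManinAdditive

section CommutingExactAtTwo

/-! ## §19 COMMUTING orbits at `2`, EXACT: `c′ ∣ c ∣ d·c′`; `χ₋₄`: `c′ = ±c ∧ deg′ = deg`;
## `χ±8`: `(c′ = ±c ∧ deg′ = 2deg) ∨ (c = ±2c′ ∧ deg = 2deg′)` -/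

/-- **E-an-22 `ExactEvenCommutingOrbitManinChain d M` — THEOREM I EXACT on a commuting same-level
`χ_d`-orbit at `2`** (`M ∣ N`, `u • (W ⊗ χ_d) = W′`, `Δ(W′) = d⁶Δ(W)`, both data lattice-optimal):
`c′ ∣ c` and `c ∣ d·c′`.  PROVED below at `(−1, M)` for `16 ∣ M` (`|c′| = |c|`) and at `(±2, M)` for
`64 ∣ M` (`c′ ∣ c ∣ 2c′`); beyond print (g3 E-an-18r had `c′ ∣ 2c ∣ 4d c′`).
[cite: Stevens1989, Lemma (5.4)] [cite: Pal2012, Lemma 3.1] -/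
def ExactEvenCommutingOrbitManinChain (d : ℤ) (M : ℕ) : Prop :=
  ∀ (W W' : WeierstrassCurve ℚ) [W.IsElliptic] [W.IsGloballyMinimal] [W'.IsElliptic]
    [W'.IsGloballyMinimal] [NeZero (W.conductorNorm ℤ)] [NeZero (W'.conductorNorm ℤ)]
    (u : VariableChange ℚ) (D : ModularParametrizationData W (W.conductorNorm ℤ))
    (D' : ModularParametrizationData W' (W'.conductorNorm ℤ)),
    M ∣ W.conductorNorm ℤ → W'.conductorNorm ℤ = W.conductorNorm ℤ →
    u • W.quadraticTwist ((d : ℤ) : ℚ) = W' → IsLatticeOptimal D → IsLatticeOptimal D' →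
    W'.Δ = ((d : ℤ) : ℚ) ^ 6 * W.Δ → D'.c ∣ D.c ∧ D.c ∣ d * D'.c

/-- **E-an-22 generic proof at `2`.** Clause 1 = clause 1 of §18 with `C = W′`; clause 2 = the engine run
BACKWARDS (`W` optimal, `A = W′`, `C = W`, `r = d`): `(g/2) z ∈ Λ_{W′} = ±(g/2)⁻¹ Λ_W ⟹ d z ∈ Λ_W`,
the twist step for `f_{W′} = f_W ⊗ χ ↦ f_W = f_{W′} ⊗ χ` needing HALF-TRANSLATE for `f_{W′}`.
[cite: Stevens1989, Lemma (5.4)] [cite: Pal2012, Lemma 3.1] -/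
theorem exactEvenCommutingOrbitManinChain_of_char {d : ℤ} (hd : d ≠ 0) {k : ℕ} [NeZero k]
    (h16 : 4 ^ 2 ∣ (2 * k) ^ 2)
    {χ : DirichletCharacter ℂ (2 * k)} (hχ : χ.IsQuadratic) (hprim : χ.IsPrimitive)
    (hG : gaussSum χ (ZMod.stdAddChar (N := 2 * k)) ^ 2 = 4 * ((d : ℤ) : ℂ))
    (hodd : ∀ (X : WeierstrassCurve ℚ) [X.IsElliptic] (n : ℕ), ¬ 2 ∣ n →
      (((X.quadraticTwist ((d : ℤ) : ℚ)).LFunction n : ℤ) : ℂ) = χ n * (X.LFunction n : ℂ))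
    (hsq : ∀ n : ℕ, ¬ 2 ∣ n → χ n * χ n = 1) (heven : ∀ n : ℕ, 2 ∣ n → χ n = 0)
    (hsumOf : ∀ {N : ℕ} [NeZero N] (f : CuspForm (Gamma0 N) 2),
      (∀ x : ℚ, modularSymbol f (x + 1 / 2) = -modularSymbol f x) →
      ∀ x : ℚ, ∃ (u₁ u₂ : ZMod (2 * k)) (ε : ℤ),
        ∑ u : ZMod (2 * k), χ u * modularSymbol f (x + twistShift u) =
          2 * (modularSymbol f (x + twistShift u₁) + ε * modularSymbol f (x + twistShift u₂)))
    {M : ℕ} (hMk : (2 * k) ^ 2 ∣ M) : ExactEvenCommutingOrbitManinChain d M := by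
  intro W W' _ _ _ _ _ _ u D D' hM hN hu hD hD' hΔ
  haveI : Fact (Nat.Prime 2) := ⟨Nat.prime_two⟩
  haveI : NeZero (2 * k) := ⟨mul_ne_zero two_ne_zero (NeZero.ne k)⟩
  have hd0 : ((d : ℤ) : ℚ) ≠ 0 := by exact_mod_cast hd
  have hMW : (2 * k) ^ 2 ∣ W.conductorNorm ℤ := hMk.trans hM
  have hM' : (2 * k) ^ 2 ∣ W'.conductorNorm ℤ := by rw [hN]; exact hMW
  have h4 : 2 ^ 2 ∣ W.conductorNorm ℤ := dvd_trans (pow_dvd_pow_of_dvd (dvd_mul_right 2 k) 2) hMW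
  have h4' : 2 ^ 2 ∣ W'.conductorNorm ℤ := dvd_trans (pow_dvd_pow_of_dvd (dvd_mul_right 2 k) 2) hM'
  obtain ⟨hngW, hnmW⟩ := not_good_and_not_mult_of_sq_dvd_conductorNorm W h4
  obtain ⟨hngW', hnmW'⟩ := not_good_and_not_mult_of_sq_dvd_conductorNorm W' h4'
  have hW0 : ∀ n : ℕ, 2 ∣ n → W.LFunction n = 0 := fun n hn ↦
    W.LFunction_apply_eq_zero_of_not_good_of_not_mult 2 hngW hnmW hn
  have hW'0 : ∀ n : ℕ, 2 ∣ n → W'.LFunction n = 0 := fun n hn ↦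
    W'.LFunction_apply_eq_zero_of_not_good_of_not_mult 2 hngW' hnmW' hn
  have hs : (gaussSum χ (ZMod.stdAddChar (N := 2 * k)) / 2) ^ 2 = ((((d : ℤ) : ℚ)) : ℂ) := by
    rw [div_pow, hG]; push_cast; ring
  have hiso : W'.LFunction = W'.LFunction := rfl
  have hcoef := fun n ↦
    cuspCoeff_eq_chi_mul_of_twist_even hd0 u hu hiso (hodd W) heven hW'0 D D' n
  have hcoef' := fun n ↦
    cuspCoeff_eq_chi_mul_of_twist_even' hd0 u hu hiso (hodd W) hsq heven hW0 D D' n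
  have hevenD : ∀ n : ℕ, 2 ∣ n → cuspCoeff D.f n = 0 := fun n hn ↦ by
    rw [D.isNewformOf.2 n, hW0 n hn, Int.cast_zero]
  have hevenD' : ∀ n : ℕ, 2 ∣ n → cuspCoeff D'.f n = 0 := fun n hn ↦ by
    rw [D'.isNewformOf.2 n, hW'0 n hn, Int.cast_zero]
  have hhalf : ∀ x : ℚ, modularSymbol D.f (x + 1 / 2) = -modularSymbol D.f x :=
    modularSymbol_add_half_eq_neg D.f (h16.trans hMW) hevenD
  have hhalf' : ∀ x : ℚ, modularSymbol D'.f (x + 1 / 2) = -modularSymbol D'.f x :=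
    modularSymbol_add_half_eq_neg D'.f (h16.trans hM') hevenD'
  have hNdvd : W.conductorNorm ℤ ∣ W'.conductorNorm ℤ := by rw [hN]
  have hNdvd' : W'.conductorNorm ℤ ∣ W.conductorNorm ℤ := by rw [hN]
  have hΔ1 : (1 : ℚ) ^ 12 * W'.Δ = ((d : ℤ) : ℚ) ^ 6 * W.Δ := by rw [one_pow, one_mul]; exact hΔ
  refine ⟨?_, ?_⟩
  · -- forward: `c′ ∣ c` (C = W′, ũ = 1)
    have hstep : ∀ w ∈ periodLattice (charTwist (W'.conductorNorm ℤ) hNdvd hM' hχ D.f),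
        gaussSum χ (ZMod.stdAddChar (N := 2 * k)) / 2 * w ∈ periodLattice D.f := fun w hw ↦
      half_gaussSum_mul_mem_periodLattice_of_mem_charTwist _ hNdvd hM' hχ hprim D.f (hsumOf D.f hhalf) hw
    have hmem : ∀ z : ℂ, gaussSum χ (ZMod.stdAddChar (N := 2 * k)) / 2 * z ∈ D.L.lattice →
        ((1 : ℤ) : ℂ) * z ∈ D'.L.lattice := fun z hz ↦ by
      rw [neronLattice_mem_iff_of_twist_of_sq_eq hd0 u hu hΔ1 hs D.isNeronLattice D'.isNeronLattice]
      convert hz using 2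
      push_cast
      ring
    simpa using
      maninConstant_dvd_mul_of_twistStep D D' hD' hχ hprim hNdvd hM' hcoef _ hstep D'.isNeronLattice 1 hmem
  · -- backward: `c ∣ d c′` (W optimal, A = W′, C = W, r = d)
    have hstep' : ∀ w ∈ periodLattice (charTwist (W.conductorNorm ℤ) hNdvd' hMW hχ D'.f),
        gaussSum χ (ZMod.stdAddChar (N := 2 * k)) / 2 * w ∈ periodLattice D'.f := fun w hw ↦
      half_gaussSum_mul_mem_periodLattice_of_mem_charTwist _ hNdvd' hMW hχ hprim D'.f
        (hsumOf D'.f hhalf') hw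
    have hmem' : ∀ z : ℂ, gaussSum χ (ZMod.stdAddChar (N := 2 * k)) / 2 * z ∈ D'.L.lattice →
        ((d : ℤ) : ℂ) * z ∈ D.L.lattice := fun z hz ↦ by
      rw [neronLattice_mem_iff_of_twist_of_sq_eq hd0 u hu hΔ1 hs D.isNeronLattice D'.isNeronLattice]
        at hz
      convert hz using 1
      rw [show gaussSum χ (ZMod.stdAddChar (N := 2 * k)) / 2 *
          ((((1 : ℚ)) : ℂ)⁻¹ * (gaussSum χ (ZMod.stdAddChar (N := 2 * k)) / 2 * z)) =
          (gaussSum χ (ZMod.stdAddChar (N := 2 * k)) / 2) ^ 2 * z by push_cast; ring, hs]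
      push_cast
      ring
    exact maninConstant_dvd_mul_of_twistStep D' D hD hχ hprim hNdvd' hMW hcoef' _ hstep'
      D.isNeronLattice d hmem'

/-- **E-an-22 at `χ₋₄`.** -/
theorem exactEvenCommutingOrbitManinChain_negOne {M : ℕ} (hM : 16 ∣ M) :
    ExactEvenCommutingOrbitManinChain (-1) M := by
  haveI : NeZero (2 : ℕ) := ⟨by norm_num⟩
  refine exactEvenCommutingOrbitManinChain_of_char (k := 2) (by norm_num) (by norm_num)
    isQuadratic_χ₄_ringHomComp isPrimitive_χ₄_ringHomComp
    (by rw [gaussSum_χ₄_ringHomComp_sq]; push_cast; ring) (fun X _ n hn ↦ ?_) (fun n hn ↦ ?_)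
    (fun n hn ↦ ?_) (fun f hhalf x ↦ ⟨1, 3, 0, sum_χ₄_modularSymbol_of_half f hhalf x⟩)
    (by simpa using hM)
  · rw [show ((-1 : ℤ) : ℚ) = -1 by norm_num, X.LFunction_quadraticTwist_neg_one_apply_of_odd hn,
      Int.cast_mul, χ₄_ringHomComp_apply_natCast]
  · rw [χ₄_ringHomComp_apply_natCast, ZMod.χ₄_nat_eq_if_mod_four,
      if_neg (fun h ↦ hn (Nat.dvd_of_mod_eq_zero h))]
    split_ifs <;> push_cast <;> ring
  · rw [χ₄_ringHomComp_apply_natCast, ZMod.χ₄_nat_eq_if_mod_four, if_pos (Nat.mod_eq_zero_of_dvd hn)]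
    simp

/-- **E-an-22 at `χ₈`.** -/
theorem exactEvenCommutingOrbitManinChain_two {M : ℕ} (hM : 64 ∣ M) :
    ExactEvenCommutingOrbitManinChain 2 M := by
  haveI : NeZero (4 : ℕ) := ⟨by norm_num⟩
  refine exactEvenCommutingOrbitManinChain_of_char (k := 4) (by norm_num) (by norm_num)
    isQuadratic_χ₈_ringHomComp isPrimitive_χ₈_ringHomComp
    (by rw [gaussSum_χ₈_ringHomComp_sq]; push_cast; ring) (fun X _ n hn ↦ ?_) (fun n hn ↦ ?_)
    (fun n hn ↦ ?_) (fun f hhalf x ↦ ⟨1, 3, -1, sum_χ₈_modularSymbol_of_half f hhalf x⟩)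
    (by simpa using hM)
  · rw [show ((2 : ℤ) : ℚ) = 2 by norm_num, X.LFunction_quadraticTwist_two_apply_of_odd hn,
      Int.cast_mul, χ₈_ringHomComp_apply_natCast]
  · rw [χ₈_ringHomComp_apply_natCast, ZMod.χ₈_nat_eq_if_mod_eight,
      if_neg (fun h ↦ hn (Nat.dvd_of_mod_eq_zero h))]
    split_ifs <;> push_cast <;> ring
  · rw [χ₈_ringHomComp_apply_natCast, ZMod.χ₈_nat_eq_if_mod_eight, if_pos (Nat.mod_eq_zero_of_dvd hn)]
    simp

/-- **E-an-22 at `χ₋₈`.** -/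
theorem exactEvenCommutingOrbitManinChain_negTwo {M : ℕ} (hM : 64 ∣ M) :
    ExactEvenCommutingOrbitManinChain (-2) M := by
  haveI : NeZero (4 : ℕ) := ⟨by norm_num⟩
  refine exactEvenCommutingOrbitManinChain_of_char (k := 4) (by norm_num) (by norm_num)
    isQuadratic_χ₈'_ringHomComp isPrimitive_χ₈'_ringHomComp
    (by rw [gaussSum_χ₈'_ringHomComp_sq]; push_cast; ring) (fun X _ n hn ↦ ?_) (fun n hn ↦ ?_)
    (fun n hn ↦ ?_) (fun f hhalf x ↦ ⟨1, 3, 1, sum_χ₈'_modularSymbol_of_half f hhalf x⟩)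
    (by simpa using hM)
  · rw [show ((-2 : ℤ) : ℚ) = -2 by norm_num, X.LFunction_quadraticTwist_neg_two_apply_of_odd hn,
      Int.cast_mul, χ₈'_ringHomComp_apply_natCast]
  · rw [χ₈'_ringHomComp_apply_natCast, ZMod.χ₈'_nat_eq_if_mod_eight,
      if_neg (fun h ↦ hn (Nat.dvd_of_mod_eq_zero h))]
    split_ifs <;> push_cast <;> ring
  · rw [χ₈'_ringHomComp_apply_natCast, ZMod.χ₈'_nat_eq_if_mod_eight, if_pos (Nat.mod_eq_zero_of_dvd hn)]
    simp

/-- PROVED edge: E-an-22 ⇒ the landed E-an-12c `CommutingOrbitManinChain d 2 M` whenever `d ∣ 2`. -/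
theorem commutingOrbitManinChain_two_of_exact {d : ℤ} {M : ℕ} (hd2 : d ∣ 2)
    (h : ExactEvenCommutingOrbitManinChain d M) : CommutingOrbitManinChain d 2 M := by
  intro W W' _ _ _ _ _ _ u D D' hM hN hu hD hD' hΔ
  obtain ⟨h1, h2⟩ := h W W' u D D' hM hN hu hD hD' hΔ
  exact ⟨h1, h2.trans (mul_dvd_mul_right (by exact_mod_cast hd2) D'.c)⟩

/-- E-an-12c `CommutingOrbitManinChain (−1) 2 M` for `16 ∣ M` (from E-an-22). -/
theorem commutingOrbitManinChain_negOne_two {M : ℕ} (hM : 16 ∣ M) : CommutingOrbitManinChain (-1) 2 M :=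
  commutingOrbitManinChain_two_of_exact (by norm_num) (exactEvenCommutingOrbitManinChain_negOne hM)

/-- E-an-12c `CommutingOrbitManinChain 2 2 M` for `64 ∣ M` (from E-an-22). -/
theorem commutingOrbitManinChain_two_two {M : ℕ} (hM : 64 ∣ M) : CommutingOrbitManinChain 2 2 M :=
  commutingOrbitManinChain_two_of_exact dvd_rfl (exactEvenCommutingOrbitManinChain_two hM)

/-- E-an-12c `CommutingOrbitManinChain (−2) 2 M` for `64 ∣ M` (from E-an-22). -/
theorem commutingOrbitManinChain_negTwo_two {M : ℕ} (hM : 64 ∣ M) : CommutingOrbitManinChain (-2) 2 M :=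
  commutingOrbitManinChain_two_of_exact (by norm_num) (exactEvenCommutingOrbitManinChain_negTwo hM)

/-- **S-an-14 at `2` as a hypothesis-free identity: on a commuting same-level `χ_d`-orbit at `2` with
`Δ(W′) = d⁶Δ(W)`, `deg′·c² = |d|·deg·c′²`** (generic in the character data). [cite: Watkins2002, §2.1] -/
theorem orbitDegreeIdentity_two_of_char {d : ℤ} (hd : d ≠ 0) {a : ℕ} (ha : |(d : ℝ)| = a)
    (ε : ℕ → ℤ) (hε : ∀ n : ℕ, ¬ 2 ∣ n → (ε n).natAbs = 1)
    (hodd : ∀ (X : WeierstrassCurve ℚ) [X.IsElliptic] (n : ℕ), ¬ 2 ∣ n →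
      (X.quadraticTwist ((d : ℤ) : ℚ)).LFunction n = ε n * X.LFunction n)
    {W W' : WeierstrassCurve ℚ} [W.IsElliptic] [W.IsGloballyMinimal] [W'.IsElliptic]
    [W'.IsGloballyMinimal] [NeZero (W.conductorNorm ℤ)] [NeZero (W'.conductorNorm ℤ)]
    (u : VariableChange ℚ) (D : ModularParametrizationData W (W.conductorNorm ℤ))
    (D' : ModularParametrizationData W' (W'.conductorNorm ℤ))
    (h4 : 2 ^ 2 ∣ W.conductorNorm ℤ) (hN : W'.conductorNorm ℤ = W.conductorNorm ℤ)
    (hu : u • W.quadraticTwist ((d : ℤ) : ℚ) = W') (hΔ : W'.Δ = ((d : ℤ) : ℚ) ^ 6 * W.Δ) :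
    (D'.modularDegree : ℤ) * D.c ^ 2 = (a : ℤ) * D.modularDegree * D'.c ^ 2 := by
  haveI : Fact (Nat.Prime 2) := ⟨Nat.prime_two⟩
  have hd0 : ((d : ℤ) : ℚ) ≠ 0 := by exact_mod_cast hd
  have h4' : 2 ^ 2 ∣ W'.conductorNorm ℤ := by rw [hN]; exact h4
  obtain ⟨hngW, hnmW⟩ := not_good_and_not_mult_of_sq_dvd_conductorNorm W h4
  obtain ⟨hngW', hnmW'⟩ := not_good_and_not_mult_of_sq_dvd_conductorNorm W' h4'
  have hW0 : ∀ n : ℕ, 2 ∣ n → W.LFunction n = 0 := fun n hn ↦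
    W.LFunction_apply_eq_zero_of_not_good_of_not_mult 2 hngW hnmW hn
  have hW'0 : ∀ n : ℕ, 2 ∣ n → W'.LFunction n = 0 := fun n hn ↦
    W'.LFunction_apply_eq_zero_of_not_good_of_not_mult 2 hngW' hnmW' hn
  have habs := natAbs_LFunction_eq_of_twist_even hd0 u hu ε hε (hodd W) hW0 hW'0
  have hu2 : ((u.u : ℚ)) ^ 2 = 1 := u_sq_eq_one_of_smul_quadraticTwist_of_Δ hd0 u hu hΔ
  have hu2R : (((u.u : ℚ)) : ℝ) ^ 2 = 1 := by exact_mod_cast hu2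
  have ha' : |((((d : ℤ) : ℚ)) : ℝ)| = a := by rw [Rat.cast_intCast]; exact ha
  exact deg_mul_c_sq_eq_of_twist_even hN hd0 u hu habs hu2R ha' D D'

/-- Elementary: `c′ ∣ c`, `c ∣ e·c′` with `|e| = 2`, `deg′c² = 2·deg·c′²`, `c′ ≠ 0` ⇒ the dichotomy. -/
theorem degDichotomy_of_chain {c c' e : ℤ} {deg deg' : ℕ} (hc' : c' ≠ 0) (h1 : c' ∣ c) (h2 : c ∣ e * c')
    (he : e.natAbs = 2) (hI : (deg' : ℤ) * c ^ 2 = (2 : ℕ) * deg * c' ^ 2) :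
    ((c' = c ∨ c' = -c) ∧ deg' = 2 * deg) ∨ ((c = 2 * c' ∨ c = -(2 * c')) ∧ deg = 2 * deg') := by
  push_cast at hI
  obtain ⟨j, hj⟩ := h1
  obtain ⟨i, hi⟩ := h2
  have he' : e = j * i := by
    apply mul_left_cancel₀ hc'
    rw [hj] at hi
    linear_combination hi
  have hj2 : j.natAbs ∣ 2 := by
    rw [← he, he', Int.natAbs_mul]
    exact dvd_mul_right _ _
  have hc2 : (c' : ℤ) ^ 2 ≠ 0 := pow_ne_zero 2 hc'
  have hc2' : (2 : ℤ) * c' ^ 2 ≠ 0 := mul_ne_zero two_ne_zero hc2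
  rw [hj] at hI
  rcases (Nat.dvd_prime Nat.prime_two).mp hj2 with hj1 | hj1
  · have hj' : j = 1 ∨ j = -1 := by
      have h := Int.natAbs_eq_iff.mp hj1
      push_cast at h
      exact h
    left
    refine ⟨?_, ?_⟩
    · rcases hj' with rfl | rfl
      · exact Or.inl (by rw [hj]; ring)
      · exact Or.inr (by rw [hj]; ring)
    · have h : (deg' : ℤ) = 2 * deg := by
        apply mul_right_cancel₀ hc2
        rcases hj' with rfl | rfl <;> linear_combination hI
      exact_mod_cast h
  · have hj' : j = 2 ∨ j = -2 := by
      have h := Int.natAbs_eq_iff.mp hj1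
      push_cast at h
      exact h
    right
    refine ⟨?_, ?_⟩
    · rcases hj' with rfl | rfl
      · exact Or.inl (by rw [hj]; ring)
      · exact Or.inr (by rw [hj]; ring)
    · have h : (deg : ℤ) = 2 * deg' := by
        apply mul_right_cancel₀ hc2'
        rcases hj' with rfl | rfl <;> linear_combination -hI
      exact_mod_cast h

/-- `|χ(n)| = 1` for odd `n` (`χ = χ₄, χ₈, χ₈′`). [elementary] -/
theorem natAbs_χ₄_of_odd (n : ℕ) (hn : ¬ 2 ∣ n) : (ZMod.χ₄ n).natAbs = 1 := by
  rw [ZMod.χ₄_nat_eq_if_mod_four, if_neg (fun h ↦ hn (Nat.dvd_of_mod_eq_zero h))]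
  split_ifs <;> rfl

/-- `|χ₈(n)| = 1` for odd `n`. [elementary] -/
theorem natAbs_χ₈_of_odd (n : ℕ) (hn : ¬ 2 ∣ n) : (ZMod.χ₈ n).natAbs = 1 := by
  rw [ZMod.χ₈_nat_eq_if_mod_eight, if_neg (fun h ↦ hn (Nat.dvd_of_mod_eq_zero h))]
  split_ifs <;> rfl

/-- `|χ₈′(n)| = 1` for odd `n`. [elementary] -/
theorem natAbs_χ₈'_of_odd (n : ℕ) (hn : ¬ 2 ∣ n) : (ZMod.χ₈' n).natAbs = 1 := by
  rw [ZMod.χ₈'_nat_eq_if_mod_eight, if_neg (fun h ↦ hn (Nat.dvd_of_mod_eq_zero h))]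
  split_ifs <;> rfl

/-- `aₙ(X ⊗ (−1)) = χ₄(n)·aₙ(X)` for odd `n`, with `d = −1` cast from `ℤ` (the tree's
`LFunction_quadraticTwist_neg_one_apply_of_odd`). -/
theorem LFunction_quadraticTwist_negOne_intCast_of_odd (X : WeierstrassCurve ℚ) [X.IsElliptic] (n : ℕ)
    (hn : ¬ 2 ∣ n) : (X.quadraticTwist (((-1 : ℤ)) : ℚ)).LFunction n = ZMod.χ₄ n * X.LFunction n := by
  rw [show ((-1 : ℤ) : ℚ) = -1 by norm_num]
  exact X.LFunction_quadraticTwist_neg_one_apply_of_odd hn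

/-- `aₙ(X ⊗ 2) = χ₈(n)·aₙ(X)` for odd `n`, with `d = 2` cast from `ℤ`. -/
theorem LFunction_quadraticTwist_two_intCast_of_odd (X : WeierstrassCurve ℚ) [X.IsElliptic] (n : ℕ)
    (hn : ¬ 2 ∣ n) : (X.quadraticTwist (((2 : ℤ)) : ℚ)).LFunction n = ZMod.χ₈ n * X.LFunction n := by
  rw [show ((2 : ℤ) : ℚ) = 2 by norm_num]
  exact X.LFunction_quadraticTwist_two_apply_of_odd hn

/-- `aₙ(X ⊗ (−2)) = χ₈′(n)·aₙ(X)` for odd `n`, with `d = −2` cast from `ℤ`. -/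
theorem LFunction_quadraticTwist_negTwo_intCast_of_odd (X : WeierstrassCurve ℚ) [X.IsElliptic] (n : ℕ)
    (hn : ¬ 2 ∣ n) : (X.quadraticTwist (((-2 : ℤ)) : ℚ)).LFunction n = ZMod.χ₈' n * X.LFunction n := by
  rw [show ((-2 : ℤ) : ℚ) = -2 by norm_num]
  exact X.LFunction_quadraticTwist_neg_two_apply_of_odd hn

/-- **E-an-23 `NegOneCommutingOrbitManinDegEq M` — THEOREM I EXACT at `χ₋₄` on commuting orbits:** on a
same-level `χ₋₄`-orbit (`M ∣ N`; proved for `16 ∣ M`) with `u • (W ⊗ χ₋₄) = W′`, `Δ(W′) = Δ(W)` and both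
data lattice-optimal, `c(D′) = ±c(D)` AND `deg φ_{W′} = deg φ_W` — E-an-10's Manin clause and the
collapse of g3's degree trichotomy E-an-20 to EQUALITY (Cremona `N < 5·10⁵`, `2⁵ ∣ N`: equal degrees on
148 277 / 148 277 such orbits; modular-symbol degrees `N < 14 000`: 2 877 / 2 877).  Beyond print. -/
def NegOneCommutingOrbitManinDegEq (M : ℕ) : Prop :=
  ∀ (W W' : WeierstrassCurve ℚ) [W.IsElliptic] [W.IsGloballyMinimal] [W'.IsElliptic]
    [W'.IsGloballyMinimal] [NeZero (W.conductorNorm ℤ)] [NeZero (W'.conductorNorm ℤ)]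
    (u : VariableChange ℚ) (D : ModularParametrizationData W (W.conductorNorm ℤ))
    (D' : ModularParametrizationData W' (W'.conductorNorm ℤ)),
    M ∣ W.conductorNorm ℤ → W'.conductorNorm ℤ = W.conductorNorm ℤ →
    u • W.quadraticTwist ((-1 : ℤ) : ℚ) = W' → IsLatticeOptimal D → IsLatticeOptimal D' →
    W'.Δ = W.Δ → (D'.c = D.c ∨ D'.c = -D.c) ∧ D'.modularDegree = D.modularDegree

/-- **E-an-23 is a THEOREM for `16 ∣ M`.** From E-an-22 at `χ₋₄` (`c′ ∣ c ∣ −c′`) and Watkins' identity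
with `|d| = 1`. -/
theorem negOneCommutingOrbitManinDegEq_holds {M : ℕ} (hM : 16 ∣ M) : NegOneCommutingOrbitManinDegEq M := by
  intro W W' _ _ _ _ _ _ u D D' hMN hN hu hD hD' hΔ
  have hΔ' : W'.Δ = ((-1 : ℤ) : ℚ) ^ 6 * W.Δ := by rw [hΔ]; norm_num
  obtain ⟨h1, h2⟩ := exactEvenCommutingOrbitManinChain_negOne hM W W' u D D' hMN hN hu hD hD' hΔ'
  have hc : D.c ≠ 0 := D.maninConstant_ne_zero_holds
  have h2' : D.c ∣ D'.c := by
    rw [neg_one_mul] at h2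
    exact (dvd_neg.mp h2)
  have habs : D'.c.natAbs = D.c.natAbs := Int.natAbs_eq_of_dvd_dvd h1 h2'
  have hcc : D'.c = D.c ∨ D'.c = -D.c := Int.natAbs_eq_natAbs_iff.mp habs
  refine ⟨hcc, ?_⟩
  have h4 : 2 ^ 2 ∣ W.conductorNorm ℤ := dvd_trans (by norm_num) (hM.trans hMN)
  have hI := orbitDegreeIdentity_two_of_char (d := -1) (by norm_num) (a := 1) (by norm_num)
    (fun n ↦ ZMod.χ₄ n) natAbs_χ₄_of_odd LFunction_quadraticTwist_negOne_intCast_of_odd u D D' h4 hN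
    hu hΔ'
  have hsq : D'.c ^ 2 = D.c ^ 2 := by
    rcases hcc with h | h
    · rw [h]
    · rw [h, neg_sq]
  rw [hsq, Nat.cast_one, one_mul] at hI
  have hc2 : (D.c : ℤ) ^ 2 ≠ 0 := pow_ne_zero 2 hc
  exact_mod_cast mul_right_cancel₀ hc2 hI

/-- **E-an-24 `TwoCommutingOrbitManinDegDichotomy d M` (`d = ±2`) — the DEGREE DICHOTOMY on commuting
`χ±8`-orbits at `2`:** (`M ∣ N`; proved for `64 ∣ M`) with `u • (W ⊗ χ_d) = W′`, `Δ(W′) = 64Δ(W)`, both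
data lattice-optimal: EITHER `c′ = ±c ∧ deg′ = 2·deg` OR `c = ±2c′ ∧ deg = 2·deg′` — Manin invariance along
the orbit ⟺ the degree DOUBLES (g3 E-an-20 had four cases). Beyond print. -/
def TwoCommutingOrbitManinDegDichotomy (d : ℤ) (M : ℕ) : Prop :=
  ∀ (W W' : WeierstrassCurve ℚ) [W.IsElliptic] [W.IsGloballyMinimal] [W'.IsElliptic]
    [W'.IsGloballyMinimal] [NeZero (W.conductorNorm ℤ)] [NeZero (W'.conductorNorm ℤ)]
    (u : VariableChange ℚ) (D : ModularParametrizationData W (W.conductorNorm ℤ))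
    (D' : ModularParametrizationData W' (W'.conductorNorm ℤ)),
    M ∣ W.conductorNorm ℤ → W'.conductorNorm ℤ = W.conductorNorm ℤ →
    u • W.quadraticTwist ((d : ℤ) : ℚ) = W' → IsLatticeOptimal D → IsLatticeOptimal D' →
    W'.Δ = ((d : ℤ) : ℚ) ^ 6 * W.Δ →
    ((D'.c = D.c ∨ D'.c = -D.c) ∧ D'.modularDegree = 2 * D.modularDegree) ∨
      ((D.c = 2 * D'.c ∨ D.c = -(2 * D'.c)) ∧ D.modularDegree = 2 * D'.modularDegree)

/-- **E-an-24 is a THEOREM at `χ₈` for `64 ∣ M`.** -/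
theorem twoCommutingOrbitManinDegDichotomy_two {M : ℕ} (hM : 64 ∣ M) :
    TwoCommutingOrbitManinDegDichotomy 2 M := by
  intro W W' _ _ _ _ _ _ u D D' hMN hN hu hD hD' hΔ
  obtain ⟨h1, h2⟩ := exactEvenCommutingOrbitManinChain_two hM W W' u D D' hMN hN hu hD hD' hΔ
  have h4 : 2 ^ 2 ∣ W.conductorNorm ℤ := dvd_trans (by norm_num) (hM.trans hMN)
  have hI := orbitDegreeIdentity_two_of_char (d := 2) (by norm_num) (a := 2) (by norm_num)
    (fun n ↦ ZMod.χ₈ n) natAbs_χ₈_of_odd LFunction_quadraticTwist_two_intCast_of_odd u D D' h4 hN hu hΔ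
  exact degDichotomy_of_chain D'.maninConstant_ne_zero_holds h1 h2 (by norm_num) hI

/-- **E-an-24 is a THEOREM at `χ₋₈` for `64 ∣ M`.** -/
theorem twoCommutingOrbitManinDegDichotomy_negTwo {M : ℕ} (hM : 64 ∣ M) :
    TwoCommutingOrbitManinDegDichotomy (-2) M := by
  intro W W' _ _ _ _ _ _ u D D' hMN hN hu hD hD' hΔ
  obtain ⟨h1, h2⟩ := exactEvenCommutingOrbitManinChain_negTwo hM W W' u D D' hMN hN hu hD hD' hΔ
  have h4 : 2 ^ 2 ∣ W.conductorNorm ℤ := dvd_trans (by norm_num) (hM.trans hMN)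
  have hI := orbitDegreeIdentity_two_of_char (d := -2) (by norm_num) (a := 2) (by norm_num)
    (fun n ↦ ZMod.χ₈' n) natAbs_χ₈'_of_odd LFunction_quadraticTwist_negTwo_intCast_of_odd u D D' h4 hN
    hu hΔ
  exact degDichotomy_of_chain D'.maninConstant_ne_zero_holds h1 h2 (by norm_num) hI

end CommutingExactAtTwo

end Summit.BirchSwinnertonDyer.Rank1Residual.ManinAdditive
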